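import Summits.MatrixMultiplication.OmegaCensus.STPPVosperSlackTwoCheckersSound

/-!
# ω-census (abelian STPP census): soundness lemmas for the slack-2 partition checkers, III — casts of residues, difference lists, value sublists (kernel tool)

HONEST FRAMING (pub-omega census; verbatim): lottery ticket; floor = certified bounds/negative ranges.
Census STRUCTURE (seat pub-omega-stpp-1 gen 32, 2026-08-28), family (b2).  Small generic facts used by the normal-form soundness lemma of the case-A
checker (`STPPVosperSlackTwoSoundA.lean`): casts of `(u + v) mod p`, `(u + p − v) mod p` into `ℤ/p`; the first translate mask; the value of a difference;
duplicate-freeness of a difference list `[(e − f) mod p : e ∈ E, f ∈ F]` from injectivity of `(e, f) ↦ e − f`; a filter by a set of values is a member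
of `sublistsLen`.  UNCONDITIONAL; no `decide`.  Nothing here is progress on `ω`.

References: H. Cohn, R. Kleinberg, B. Szegedy, C. Umans, FOCS 2005 (arXiv:math/0511460), Def. 5.1.
-/

open Finset

namespace Summit.MatrixMultiplication.OmegaCensus.CubeNB.S2

open Summit.MatrixMultiplication.OmegaCensus.CubeNB.Bits

section Casts

variable {p : ℕ} [hp : Fact p.Prime]

/-- `((n mod p : ℕ) : ℤ/p) = n`. [folklore] -/
theorem cast_mod_self (n : ℕ) : (((n % p : ℕ)) : ZMod p) = (n : ZMod p) := by
  have h := Nat.mod_add_div n p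
  conv_rhs => rw [← h]
  push_cast
  rw [ZMod.natCast_self, zero_mul, add_zero]

/-- Cast of `(u + v) mod p`. [folklore] -/
theorem cast_add_mod (u v : ℕ) : ((((u + v) % p : ℕ)) : ZMod p) = (u : ZMod p) + v := by
  rw [cast_mod_self]; push_cast; rfl

/-- Cast of `(u + p − v) mod p` (`v ≤ u + p`). [folklore] -/
theorem cast_add_sub_mod {u v : ℕ} (hv : v ≤ u + p) : ((((u + p - v) % p : ℕ)) : ZMod p) = (u : ZMod p) - v := by
  rw [cast_mod_self, Nat.cast_sub hv]; push_cast; rw [ZMod.natCast_self, add_zero]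

/-- The value of a difference: `(e.val + p − f.val) mod p = (e − f).val`. [folklore] -/
theorem val_sub_eq_mod (e f : ZMod p) : (e.val + p - f.val) % p = (e - f).val := by
  have h' : ((((e.val + p - f.val) % p : ℕ)) : ZMod p) = e - f := by
    rw [cast_add_sub_mod (by have := f.val_lt; omega), ZMod.natCast_zmod_val, ZMod.natCast_zmod_val]
  have := congrArg ZMod.val h'
  rwa [ZMod.val_natCast, Nat.mod_eq_of_lt (Nat.mod_lt _ hp.out.pos)] at this

/-- **Difference lists are duplicate-free** when `(e, f) ↦ e − f` is injective on `SE × SF`: for value lists `E` of `SE` and `F` of `SF` (duplicate-free),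
`[(e + p − f) mod p : e ∈ E, f ∈ F]` is duplicate-free. [cite: CohnKleinbergSzegedyUmans2005, Def. 5.1] -/
theorem nodup_flatMap_diff (E F : List ℕ) (SE SF : Finset (ZMod p)) (hE : E.Nodup) (hF : F.Nodup)
    (hEm : ∀ v, v ∈ E ↔ ∃ e ∈ SE, e.val = v) (hFm : ∀ v, v ∈ F ↔ ∃ f ∈ SF, f.val = v)
    (hinj : ∀ e ∈ SE, ∀ e' ∈ SE, ∀ f ∈ SF, ∀ f' ∈ SF, e - f = e' - f' → e = e' ∧ f = f') :
    (E.flatMap fun e => F.map fun f => (e + p - f) % p).Nodup := by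
  rw [List.nodup_flatMap]
  constructor
  · intro e he
    refine List.Nodup.map_on (fun f hf f' hf' hff => ?_) hF
    obtain ⟨ee, hee, rfl⟩ := (hEm e).1 he
    obtain ⟨ff, hff1, rfl⟩ := (hFm f).1 hf
    obtain ⟨ff', hff2, rfl⟩ := (hFm f').1 hf'
    rw [val_sub_eq_mod, val_sub_eq_mod] at hff
    rw [(hinj ee hee ee hee ff hff1 ff' hff2 (ZMod.val_injective p hff)).2]
  · refine hE.imp_of_mem ?_
    intro e e' he he' hne v hv hv'
    rw [List.mem_map] at hv hv'
    obtain ⟨f, hf, rfl⟩ := hv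
    obtain ⟨f', hf', hff⟩ := hv'
    obtain ⟨ee, hee, rfl⟩ := (hEm e).1 he
    obtain ⟨ee', hee', rfl⟩ := (hEm e').1 he'
    obtain ⟨ff, hff1, rfl⟩ := (hFm f).1 hf
    obtain ⟨ff', hff2, rfl⟩ := (hFm f').1 hf'
    rw [val_sub_eq_mod, val_sub_eq_mod] at hff
    exact hne (by rw [(hinj ee' hee' ee hee ff' hff2 ff hff1 (ZMod.val_injective p hff)).1])

end Casts

/-- The first translate mask is the one at position `0`. [folklore] -/
theorem transMasks_headD {p : ℕ} (patt : List ℕ) (hp0 : 0 < p) :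
    ((transMasks p patt).headD (0, 0)).2 = maskOf (patt.map fun y => (0 + p - y) % p) := by
  obtain ⟨n, hn⟩ : ∃ n, p = n + 1 := ⟨p - 1, by omega⟩
  rw [transMasks, hn, List.range_succ_eq_map]
  rfl

/-- **A filter by a set of values is an enumerated sublist**: for a duplicate-free list `l` containing every member of `S`, `l.filter (∈ S)` belongs to
`l.sublistsLen #S`. [folklore] -/
theorem filter_mem_sublistsLen (l : List ℕ) (hl : l.Nodup) (S : Finset ℕ) (hS : ∀ v ∈ S, v ∈ l) :
    (l.filter fun v => decide (v ∈ S)) ∈ l.sublistsLen #S := by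
  refine List.mem_sublistsLen.2 ⟨List.filter_sublist, ?_⟩
  have hnd : (l.filter fun v => decide (v ∈ S)).Nodup := hl.filter _
  have hset : (l.filter fun v => decide (v ∈ S)).toFinset = S := by
    ext v
    rw [List.mem_toFinset, List.mem_filter, decide_eq_true_eq]
    exact ⟨fun h => h.2, fun h => ⟨hS v h, h⟩⟩
  rw [← List.toFinset_card_of_nodup hnd, hset]


/-- **Splitting a range of shapes**: the `all` over `qShapes p b lo hi` is the conjunction of the `all`s over `[lo, mid)` and `[mid, hi)` — used to
assemble chunked `decide` rows. [folklore] -/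
theorem all_qShapes_append (p b lo mid hi : ℕ) (h1 : lo ≤ mid) (h2 : mid ≤ hi) (f : List ℕ → Bool) :
    (qShapes p b lo hi).all f = ((qShapes p b lo mid).all f && (qShapes p b mid hi).all f) := by
  unfold qShapes
  rw [← List.all_append]
  congr 1
  rw [show hi - lo = (mid - lo) + (hi - mid) by omega, List.take_add, List.drop_drop]
  congr 3
  omega


/-- **Splitting a window of a list**: the `all` over `(l.drop lo).take (n + m)` is the conjunction over `(l.drop lo).take n` and `(l.drop (lo + n)).take m`
— assembles single-shape `decide` rows. [folklore] -/
theorem all_drop_take_add {α : Type*} (l : List α) (lo n m : ℕ) (f : α → Bool) :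
    ((l.drop lo).take (n + m)).all f = (((l.drop lo).take n).all f && ((l.drop (lo + n)).take m).all f) := by
  rw [← List.all_append, List.take_add, List.drop_drop]

/-- The whole list as a window. [folklore] -/
theorem all_eq_all_drop_zero_take {α : Type*} (l : List α) (n : ℕ) (hn : l.length ≤ n) (f : α → Bool) :
    l.all f = ((l.drop 0).take n).all f := by
  rw [List.drop_zero, List.take_of_length_le hn]

end Summit.MatrixMultiplication.OmegaCensus.CubeNB.S2
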